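import Mathlib
import Summits.ValiantsHypothesis.ValiantsHypothesis.Theorems.DivisionGapPerMultiplesHardSpreadPatternsRel
import Summits.ValiantsHypothesis.ValiantsHypothesis.Theorems.DivisionGapPerMultiplesHardStubTypedDecompositionL
import Literature.Computability.AlgebraicComplexity.ArithCircuitProofs
import Literature.Computability.AlgebraicComplexity.PermanentIrreducible

/-!
# The relative spread engine with a variable window (line `uncharged-face-walk` of crux
`PerMultiplesHard`, route DivisionGap; stub `stub_spreadPatternsRelD`)

The `D`-window form of the relative spread engine `SpreadPatternsRel.stub_spreadPatternsRel`: for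
`3 ≤ D ≤ n`, a row shift `ζ`, a torus-homogeneous `g ∈ ℝ≥0[x_ij]` (margins `(R, C)`) with all
rows hit and ANY comparison set `P` of permutations, some typed rectangle `(S, T)` with row support
in the window `n < D · #S ≤ 2n` captures a `1 / L(g)` fraction of the probed part of `P`:
`#{π ∈ P : supp g has a ζ-spread probe for π} ≤ L(g) · #{π ∈ P : π compatible with (S, T)}`
(`L = complexity` over `ℝ≥0`).

Proof: identical to `stub_spreadPatternsRel`, with the typed decomposition in the window
`n < 5 · #S ≤ 2n` replaced by `TypedDecompositionL.stub_typedDecompositionL` (window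
`n < D · #S ≤ 2n`); the counting (`SpreadPatternsRel.relCount_le_mul_max`) and the compatibility of
a probed permutation with the type of the probed factor (`SpreadPatterns.spreadCompatible_of_probe`)
are reused by name.  If the decomposition is empty then `g = 0`, nothing is probed, and any
`⌊n/D⌋ + 1` rows form a window set (`exists_window_setD`).

-- adapted from Theorems/DivisionGapPerMultiplesHardSpreadPatternsRel.lean (`exists_window_set`,
`stub_spreadPatternsRel`, with the constant window `5` replaced by `D`)
-/

noncomputable section

-- the namespace `Summit.ValiantsHypothesis.ValiantsHypothesis.…` is mandated by the crux (registered stub names)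
set_option linter.dupNamespace false

namespace Summit.ValiantsHypothesis.ValiantsHypothesis.Theorems.DivisionGap.PerMultiplesHard.SpreadPatternsRelD

open MvPolynomial Literature.Computability.AlgebraicComplexity
open scoped NNReal BigOperators

/-- **A `D`-window set exists.**  For `2 ≤ D ≤ n` there is a set `S` of rows with
`n < D · #S ≤ 2n`: any `⌊n/D⌋ + 1` rows (`⌊n/D⌋ < n`, `D(⌊n/D⌋ + 1) > n` and
`D(⌊n/D⌋ + 1) ≤ n + D ≤ 2n`). [folklore] -/
theorem exists_window_setD (n D : ℕ) (hD : 2 ≤ D) (hDn : D ≤ n) :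
    ∃ S : Finset (Fin n), n < D * S.card ∧ D * S.card ≤ 2 * n := by
  classical
  have hdiv : D * (n / D) ≤ n := Nat.mul_div_le n D
  have hlt : n < D * (n / D + 1) := Nat.lt_mul_div_succ n (by omega)
  have hself : n / D < n := Nat.div_lt_self (by omega) (by omega)
  have hle : n / D + 1 ≤ (Finset.univ : Finset (Fin n)).card := by
    rw [Finset.card_univ, Fintype.card_fin]; exact hself
  obtain ⟨S, -, hS⟩ := Finset.exists_subset_card_eq hle
  refine ⟨S, ?_, ?_⟩
  · rw [hS]; exact hlt
  · rw [hS, Nat.mul_add, Nat.mul_one]; omega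

/-- **stub_spreadPatternsRelD — the relative spread engine with a `D`-window, rows.**  For
`3 ≤ D ≤ n`, a row shift `ζ`, a torus-homogeneous `g` (margins `(R, C)`) with all rows hit and ANY
comparison set `P` of permutations, some typed rectangle `(S, T)` with row support in the window
`n < D · #S ≤ 2n` has
`#{π ∈ P : supp g has a ζ-spread probe for π} ≤ L(g) · #{π ∈ P : π compatible with (S, T)}`.
Proof: `stub_typedDecompositionL` gives `g = Σ_{t<s} a_t b_t`, `s ≤ L(g)`, `a_t` typed in the
`D`-window; a probe of `a_t b_t` for `π` makes `π` compatible with the type of `a_t`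
(`SpreadPatterns.spreadCompatible_of_probe`); so the probed part of `P` lies in the union over `t`
of the compatible parts of `P`, of total size `≤ s · max_t` (`SpreadPatternsRel.relCount_le_mul_max`).
If `s = 0` then `g = 0`, the probed set is empty, and any window set (`exists_window_setD`) with
`T = ∅` will do. [folklore] -/
theorem stub_spreadPatternsRelD :
    ∀ (n D : ℕ), 3 ≤ D → D ≤ n → ∀ (ζ : Equiv.Perm (Fin n)) (g : MvPolynomial (Fin n × Fin n) ℝ≥0) (R C : Fin n → ℕ),
      (∀ m ∈ g.support, (∀ i, ∑ j, m (i, j) = R i) ∧ (∀ j, ∑ i, m (i, j) = C j)) →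
      (∀ i, R i ≠ 0) →
      ∀ P : Finset (Equiv.Perm (Fin n)), ∃ S T : Finset (Fin n),
        n < D * S.card ∧ D * S.card ≤ 2 * n ∧
        (P.filter fun π => ∃ m ∈ g.support, ∀ e ∈ m.support, π e.2 = e.1 ∨ π e.2 = ζ e.1).card ≤
          complexity g *
            (P.filter fun π => (∀ i ∈ S, π.symm i ∈ T ∨ π.symm (ζ i) ∈ T) ∧
              (∀ j ∈ T, π j ∈ S ∨ ∃ i ∈ S, ζ i = π j)).card := by
  classical
  intro n D hD hDn ζ g R C hg hR P
  obtain ⟨s, hs, a, b, hgab, htyp⟩ :=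
    Summit.ValiantsHypothesis.ValiantsHypothesis.Theorems.DivisionGap.PerMultiplesHard.TypedDecompositionL.stub_typedDecompositionL
      n D hD hDn g R C hg hR
  rcases Nat.eq_zero_or_pos s with rfl | hs0
  · -- `g = Σ_{t ∈ Fin 0} a_t b_t = 0`: nothing is probed; any window set will do
    obtain ⟨S, hlo, hhi⟩ := exists_window_setD n D (by omega) hDn
    refine ⟨S, ∅, hlo, hhi, ?_⟩
    have hg0 : g = 0 := by rw [hgab]; exact Fin.sum_univ_zero _
    have hempty : (P.filter fun π =>
        ∃ m ∈ g.support, ∀ e ∈ m.support, π e.2 = e.1 ∨ π e.2 = ζ e.1) = ∅ := by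
      refine Finset.filter_eq_empty_iff.mpr ?_
      rintro π - ⟨m, hm, -⟩
      rw [hg0, MvPolynomial.support_zero] at hm
      exact Finset.notMem_empty _ hm
    rw [hempty, Finset.card_empty]
    exact Nat.zero_le _
  · -- `s > 0`: choose the types; a probe of `a_t b_t` forces compatibility with the type of `a_t`
    have htyp' : ∀ t, ∃ ρ γ : Fin n → ℕ,
        (∀ m ∈ (a t).support, (∀ i, ∑ j, m (i, j) = ρ i) ∧ (∀ j, ∑ i, m (i, j) = γ j)) ∧
        n < D * (Finset.univ.filter fun i => ρ i ≠ 0).card ∧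
        D * (Finset.univ.filter fun i => ρ i ≠ 0).card ≤ 2 * n := fun t => (htyp t).2
    choose ρ γ hty hlo hhi using htyp'
    obtain ⟨t₀, ht₀⟩ := SpreadPatternsRel.relCount_le_mul_max hs0 ζ g a b hgab
      (fun t => Finset.univ.filter fun i => ρ t i ≠ 0) (fun t => Finset.univ.filter fun j => γ t j ≠ 0) P
      (fun t π hπ => by
        obtain ⟨hπP, m, hm, hprobe⟩ := Finset.mem_filter.mp hπ
        exact Finset.mem_filter.mpr
          ⟨hπP, SpreadPatterns.spreadCompatible_of_probe hm π hprobe (hty t)⟩)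
    exact ⟨_, _, hlo t₀, hhi t₀, ht₀.trans (Nat.mul_le_mul_right _ hs)⟩

end Summit.ValiantsHypothesis.ValiantsHypothesis.Theorems.DivisionGap.PerMultiplesHard.SpreadPatternsRelD

end
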